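import Summits.CriticalPhenomena.PercolationContinuityZ3.Theorems.PercNearOneGluingNoHeavyLowerTailSunflowerMultiPetalKempePinned
import HarnessLib
import HarnessLib.Audit

/-!
# `NoHeavyLowerTail` (crux stmt-CriticalPhenomena-4575), Lemma B for graph clutters: the PINNED CLASSES BY BOUNDARY PROFILE —
# which classes of the pinned one-point obligation are automatic, and what the remaining ones are

Support file (seat `prim-l12-p2` gen 41; `--supports stmt-CriticalPhenomena-4575`; continuation of `…SunflowerMultiPetalKempePinned` (p414773:
`pinnedClass`, `kerMZ`, `kerMZ_eq_kerAbs`, `prof3`, `kerAbs`, `xPart`, `PinnedMZ`)).  No `sorry`; nothing is asserted about the crux.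
Memo: run/shared/lean/prim/prim-l12/prim-l12-p2/FINDING-g41-TWO-TERMINAL-REDUCTION.md §1 (THEOREM R).

On a pinned class (colourings of `V ∖ {x}` agreeing with `κ` on `N(x)`) the colour profile of `N(x)` is constant — it is the BOUNDARY PROFILE
`bprof κ` of `κ` (`prof_eq_bprof`, `prof3_eq_bprof3`) — so the one-point kernel is `kerAbs (type τ) (bprof3 κ)` throughout the class
(`kerMZ_eq_of_mem`).  Consequences (the class-level form of the pointwise facts of p414773, i.e. the automatic half of the memo's THEOREM R):
* `pinned_sum_nonneg_of_forall_ne_zero`: if every colour occurs on `N(x)` under `κ`, the class sum is `≥ 0`;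
* `pinned_sum_nonneg_of_two_two`: likewise if two colours are saturated (each on ≥ 2 neighbours);
* `pinnedMZ_of_absent`: hence `PinnedMZ` reduces to the boundary colourings with an ABSENT colour and at most one saturated colour;
* `pinned_sum_const`: for a constant boundary colouring `κ ≡ a` the class sum is `Σ_class [lbW (t ⊕ d·e_a) + lbW t]` — the Lemma-B weights of the
  contracted graph `(G−x)/N(x)` with `d = min(deg x, 2)` marks and without marks (memo §1: a Lemma-B instance on fewer vertices);
* `pinned_sum_ge_twoTerminal`: for a two-coloured boundary with colour `b` on exactly one neighbour and colour `a` on the others, the class sum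
  dominates `Σ_class fC2 a b t`, the TWO-TERMINAL weight of the memo's inequality (C) on the contracted graph `(G−x)/A`.
All pointwise ingredients are finite checks over `Fin 3`-valued types (`decide`).
-/

namespace Summit.CriticalPhenomena.PercolationContinuityZ3.Theorems.SunflowerPartition.Kempe

open Finset
open scoped Classical

/-! ## Coordinates of a type and colour-general pointwise facts (finite checks) -/

/-- The `c`-coordinate of a type / profile. [this work] -/
def coord (d : CType) (c : Fin 3) : Fin 3 := if c = 0 then d.1 else if c = 1 then d.2.1 else d.2.2

/-- The unit profile at colour `a` scaled to `k`: `xPart a (k,k,k)`. [this work] -/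
theorem coord_xPart (a c : Fin 3) (d : CType) : coord (xPart a d) c = if c = a then coord d c else 0 := by
  revert a c d; decide

/-- The TWO-TERMINAL WEIGHT for terminal colours `a ≠ b`: `fC2 a b t = lbW (t + e_a) + lbW (t + e_b)` (`fC = fC2 0 1`). [this work] -/
def fC2 (a b : Fin 3) (t : CType) : ℤ := lbW (ctAdd t (xPart a (1, 1, 1))) + lbW (ctAdd t (xPart b (1, 1, 1)))

/-- `fC2 0 1 = fC`. [this work] -/
theorem fC2_zero_one : ∀ t : CType, fC2 0 1 t = fC t := by decide

/-- CONSTANT BOUNDARY of any colour `a` and capped size `k`: `kerAbs t (k·e_a) = lbW (t ⊕ k·e_a) + lbW t`. [this work] -/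
theorem kerAbs_const (a : Fin 3) (k : Fin 3) : ∀ t : CType,
    kerAbs t (xPart a (k, k, k)) = lbW (ctAdd t (xPart a (k, k, k))) + lbW t := by
  revert a k; decide

/-- TWO-COLOURED BOUNDARY `(≥1 of colour a, exactly 1 of colour b, 0 of the third)`: the kernel dominates the two-terminal weight `fC2 a b`
(with equality when colour `a` occurs exactly once). [this work] -/
theorem fC2_le_kerAbs : ∀ (a b : Fin 3) (t d : CType), a ≠ b → coord d a ≠ 0 → coord d b = 1 →
    (∀ c, c ≠ a → c ≠ b → coord d c = 0) → fC2 a b t ≤ kerAbs t d := by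
  decide

/-- NO ABSENT COLOUR, coordinate form. [this work] -/
theorem kerAbs_nonneg_of_coord_ne_zero : ∀ t d : CType, (∀ c, coord d c ≠ 0) → 0 ≤ kerAbs t d := by decide

section Classes

variable {V : Type*} [Fintype V] (G : SimpleGraph V) (x : V)

/-! ## The boundary profile of `κ` and its agreement with the profile on the pinned class -/

/-- `bprof κ c`: the number of neighbours of `x` coloured `c` by the boundary colouring `κ`. [this work] -/
noncomputable def bprof (κ : V → Fin 3) (c : Fin 3) : ℕ := (univ.filter fun w : V => G.Adj x w ∧ κ w = c).card

/-- The capped BOUNDARY PROFILE of `κ`. [this work] -/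
noncomputable def bprof3 (κ : V → Fin 3) : CType := (cap3 (bprof G x κ 0), cap3 (bprof G x κ 1), cap3 (bprof G x κ 2))

/-- On the pinned class of `κ` the colour profile of `N(x)` is the boundary profile of `κ`. [this work] -/
theorem prof_eq_bprof {κ : V → Fin 3} {τ : (({x}ᶜ : Set V)) → Fin 3} (hτ : τ ∈ pinnedClass G x κ) (c : Fin 3) :
    prof G x τ c = bprof G x κ c := by
  simp only [pinnedClass, mem_filter, mem_univ, true_and] at hτ
  unfold prof bprof
  refine card_bij (fun w _ => w.1) (fun w hw => ?_) (fun w₁ _ w₂ _ h => Subtype.ext h) (fun w hw => ?_)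
  · simp only [mem_filter, mem_univ, true_and] at hw ⊢
    exact ⟨hw.1, by rw [← hτ w hw.1]; exact hw.2⟩
  · simp only [mem_filter, mem_univ, true_and] at hw
    have hwx : w ≠ x := fun h => G.ne_of_adj hw.1 h.symm
    refine ⟨⟨w, Set.mem_compl_singleton_iff.mpr hwx⟩, ?_, rfl⟩
    simp only [mem_filter, mem_univ, true_and]
    exact ⟨hw.1, by rw [hτ _ hw.1]; exact hw.2⟩

/-- Hence the capped profiles agree. [this work] -/
theorem prof3_eq_bprof3 {κ : V → Fin 3} {τ : (({x}ᶜ : Set V)) → Fin 3} (hτ : τ ∈ pinnedClass G x κ) :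
    prof3 G x τ = bprof3 G x κ := by
  unfold prof3 bprof3
  rw [prof_eq_bprof G x hτ 0, prof_eq_bprof G x hτ 1, prof_eq_bprof G x hτ 2]

/-- On the pinned class the kernel is `kerAbs (type τ) (bprof3 κ)`. [this work] -/
theorem kerMZ_eq_of_mem {κ : V → Fin 3} {τ : (({x}ᶜ : Set V)) → Fin 3} (hτ : τ ∈ pinnedClass G x κ) :
    kerMZ G x τ = kerAbs (ctype (G.induce ({x}ᶜ : Set V)) τ) (bprof3 G x κ) := by
  rw [kerMZ_eq_kerAbs, prof3_eq_bprof3 G x hτ]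

/-- Coordinates of the boundary profile. [this work] -/
theorem coord_bprof3 (κ : V → Fin 3) (c : Fin 3) : coord (bprof3 G x κ) c = cap3 (bprof G x κ c) := by
  unfold coord bprof3
  fin_cases c <;> simp

/-- A colour that occurs on `N(x)` has a nonzero capped boundary count. [this work] -/
theorem coord_bprof3_ne_zero {κ : V → Fin 3} {c : Fin 3} (h : ∃ w, G.Adj x w ∧ κ w = c) : coord (bprof3 G x κ) c ≠ 0 := by
  rw [coord_bprof3, Ne, ← eq_zero_iff_cap3]
  unfold bprof
  rw [card_eq_zero]
  obtain ⟨w, hw⟩ := h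
  exact Nonempty.ne_empty ⟨w, by simp only [mem_filter, mem_univ, true_and]; exact hw⟩

/-! ## Automatic classes -/

/-- **NO ABSENT COLOUR ⇒ THE CLASS IS AUTOMATIC**: if every colour occurs on `N(x)` under `κ`, the pinned class sum is nonnegative (pointwise). [this work] -/
theorem pinned_sum_nonneg_of_forall_ne_zero (κ : V → Fin 3) (h : ∀ c : Fin 3, ∃ w, G.Adj x w ∧ κ w = c) :
    0 ≤ ∑ τ ∈ pinnedClass G x κ, kerMZ G x τ := by
  refine sum_nonneg fun τ hτ => ?_
  rw [kerMZ_eq_of_mem G x hτ]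
  exact kerAbs_nonneg_of_coord_ne_zero _ _ fun c => coord_bprof3_ne_zero G x (h c)

/-- **TWO SATURATED COLOURS ⇒ AUTOMATIC**: if two distinct colours each occur on at least two neighbours of `x`, the class sum is nonnegative. [this work] -/
theorem pinned_sum_nonneg_of_two_two (κ : V → Fin 3) {a b : Fin 3} (hab : a ≠ b) (ha : 2 ≤ bprof G x κ a) (hb : 2 ≤ bprof G x κ b) :
    0 ≤ ∑ τ ∈ pinnedClass G x κ, kerMZ G x τ := by
  have key : ∀ (a b : Fin 3) (t d : CType), a ≠ b → coord d a = 2 → coord d b = 2 → 0 ≤ kerAbs t d := by decide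
  refine sum_nonneg fun τ hτ => ?_
  rw [kerMZ_eq_of_mem G x hτ]
  refine key a b _ _ hab ?_ ?_
  · rw [coord_bprof3]; exact ((two_le_iff_cap3 _).1 ha)
  · rw [coord_bprof3]; exact ((two_le_iff_cap3 _).1 hb)

/-- **`PinnedMZ` REDUCES TO BOUNDARY COLOURINGS WITH AN ABSENT COLOUR**: it suffices to treat the classes of those `κ` under which some colour
does not occur on `N(x)`. [this work] -/
theorem pinnedMZ_of_absent
    (h : ∀ (V : Type) [Fintype V] (G : SimpleGraph V) (x : V), G.Connected → (G.induce ({x}ᶜ : Set V)).Connected →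
      ∀ κ : V → Fin 3, (∃ c : Fin 3, ∀ w, G.Adj x w → κ w ≠ c) → 0 ≤ ∑ τ ∈ pinnedClass G x κ, kerMZ G x τ) :
    PinnedMZ := by
  intro V _ G x hG hx κ
  by_cases habs : ∃ c : Fin 3, ∀ w, G.Adj x w → κ w ≠ c
  · exact h V G x hG hx κ habs
  · have habs' : ∀ c : Fin 3, ∃ w, G.Adj x w ∧ κ w = c := fun c => by
      by_contra hne
      exact habs ⟨c, fun w hw hwc => hne ⟨w, hw, hwc⟩⟩
    exact pinned_sum_nonneg_of_forall_ne_zero G x κ habs'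

/-! ## The two remaining kinds of classes, as explicit functionals -/

/-- **CONSTANT BOUNDARY**: if `κ ≡ a` on `N(x)`, the class sum is `Σ_class [lbW (t ⊕ k·e_a) + lbW t]` with `k = min(deg x, 2)` — the Lemma-B
weights of the contracted graph `(G − x)/N(x)` with `k` marks at the contracted vertex and without (memo §1). [this work] -/
theorem pinned_sum_const (κ : V → Fin 3) (a : Fin 3) (hκ : ∀ w, G.Adj x w → κ w = a) :
    ∑ τ ∈ pinnedClass G x κ, kerMZ G x τ =
      ∑ τ ∈ pinnedClass G x κ,
        (lbW (ctAdd (ctype (G.induce ({x}ᶜ : Set V)) τ) (xPart a (bprof3 G x κ))) + lbW (ctype (G.induce ({x}ᶜ : Set V)) τ)) := by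
  have hprof : bprof3 G x κ = xPart a (bprof3 G x κ) := by
    have h0 : ∀ c, c ≠ a → bprof G x κ c = 0 := fun c hc => by
      unfold bprof; rw [card_eq_zero, filter_eq_empty_iff]
      rintro w - ⟨hw, hc'⟩; exact hc (hc'.symm.trans (hκ w hw))
    unfold bprof3 xPart
    ext <;> simp only <;> split_ifs with h <;> first | rfl | (rw [h0 _ (fun e => h e.symm)]; rfl)
  have key : ∀ (a : Fin 3) (t d : CType), kerAbs t (xPart a d) = lbW (ctAdd t (xPart a (xPart a d))) + lbW t := by decide
  refine sum_congr rfl fun τ hτ => ?_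
  rw [kerMZ_eq_of_mem G x hτ, hprof, key, ← hprof]

/-- **TWO-COLOURED BOUNDARY**: if under `κ` colour `b` occurs on exactly one neighbour of `x`, colour `a ≠ b` on at least one, and the third
colour on none, the class sum DOMINATES the two-terminal functional `Σ_class fC2 a b (type τ)` of the memo's inequality (C) on the contracted
graph `(G − x)/A` (equality when `a` occurs once). [this work] -/
theorem pinned_sum_ge_twoTerminal (κ : V → Fin 3) {a b : Fin 3} (hab : a ≠ b) (ha : 1 ≤ bprof G x κ a) (hb : bprof G x κ b = 1)
    (hc : ∀ c, c ≠ a → c ≠ b → bprof G x κ c = 0) :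
    ∑ τ ∈ pinnedClass G x κ, fC2 a b (ctype (G.induce ({x}ᶜ : Set V)) τ) ≤ ∑ τ ∈ pinnedClass G x κ, kerMZ G x τ := by
  refine sum_le_sum fun τ hτ => ?_
  rw [kerMZ_eq_of_mem G x hτ]
  refine fC2_le_kerAbs a b _ _ hab ?_ ?_ (fun c hca hcb => ?_)
  · rw [coord_bprof3, Ne, ← eq_zero_iff_cap3]; omega
  · rw [coord_bprof3, ← eq_one_iff_cap3]; exact hb
  · rw [coord_bprof3, ← (eq_zero_iff_cap3 _).1 (hc c hca hcb)]

end Classes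

end Summit.CriticalPhenomena.PercolationContinuityZ3.Theorems.SunflowerPartition.Kempe
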